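import Summits.BirchSwinnertonDyer.BirchSwinnertonDyer.Theorems.BiquadraticEisensteinDescentHeegnerTwistCouplingInSupplyQuarticCell
import Summits.BirchSwinnertonDyer.BirchSwinnertonDyer.Theorems.BiquadraticEisensteinDescentHeegnerTwistCouplingInSupplyCornersThreeFacts
import Summits.BirchSwinnertonDyer.BirchSwinnertonDyer.Theorems.BiquadraticEisensteinDescentHeegnerTwistCouplingInSupplyQuarticTwistCorner
import Summits.BirchSwinnertonDyer.BirchSwinnertonDyer.Theorems.InertBadSignedBranchesInertBadAtThreeOffIstarZeroNoQuadraticTwin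
import Literature.NumberTheory.EllipticCurves.QuarticTwistEntireLFunction
import Literature.NumberTheory.EllipticCurves.ComplexMultiplicationHasCMProofs
import Literature.NumberTheory.EllipticCurves.ComplexMultiplicationMaximalOrderProofs
import Literature.NumberTheory.EllipticCurves.ComplexMultiplicationLFunctionTableProofs
import Literature.NumberTheory.EllipticCurves.BSDSelmerCMPConverse
import Literature.NumberTheory.EllipticCurves.AnalyticRankOrderProofs
import Literature.NumberTheory.EllipticCurves.NonEisensteinPrimeOfSurjective
import Literature.NumberTheory.EllipticCurves.CongruentNumberCurveSupersingular
import Literature.NumberTheory.EllipticCurves.LFunctionPrimeCoeff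
import Literature.NumberTheory.EllipticCurves.QuadraticTwist
import HarnessLib

set_option linter.dupNamespace false -- `Summit.BirchSwinnertonDyer.BirchSwinnertonDyer.Theorems.…` (summit = sub)
set_option autoImplicit false

/-!
# Crux `HeegnerTwistCouplingInSupply` (stmt-BirchSwinnertonDyer-21381) — ★★ the QUARTIC CORNER: for every prime `p ≡ 15 (mod 16)` in the
# partner-ladder classes and `W = X_p : y² = x³ + p x` or `W = X_{p³} : y² = x³ + p³ x` (`j = 1728`, Kodaira III / III* at `p`), a Heegner
# field `K′` of `N(W)` with `4 < |d_{K′}|`, `L(W^{(d_{K′})}, 1) ≠ 0`, `h(K′) < p`, `p ∤ h(K′)` — modulo Burungale–Tian ONLY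

Route `BiquadraticEisensteinDescent` (cell `pub/bsd-wall`, width seat `bsd-wall-cm-bed-w3` g12; `--supports` 21381, helper). Fourth file on
the QUARTIC members of the CM-inert-bad corner of crux 21381 (`…QuarticLocal`, `…QuarticCellPhiHat`, `…QuarticCell`: the complete
`2`-isogeny descent of `X_{p^k q² l²}` in the cell `p ≡ 15 (mod 16)`, `q ≡ 3 (mod 8)`, `(q/p) = +1`, `l ≡ 5 (mod 8)`, `(l/p) = −1`, giving
`corank_{ℤ₂} Sel_{2^∞}(X_{p^k q² l²}/ℚ) = 0` UNCONDITIONALLY). The members `X_A : y² = x³ + A x`, `A ∈ {p, p³}`, `p ≡ 3 (mod 4)`, are the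
additive curves of Kodaira type III / III* at `p` — local type `e = 4`, depth-zero supercuspidal — with CM by `ℤ[i]` and `p` inert; their root
number is `−1` exactly for `p ≡ 15 (mod 16)` (PARI, kit j314587), the class treated here. All earlier corner theorems of this layer
(`…IndefinitePinCorner`, `…CornersThreeFacts`, `…PartnerLadderRungs`, `…SqrtTwoCorner…`) concern quadratic-twist members (`e = 2`).

Assembly (§3 ★★ `cruxOnQuarticCorner_of_BT`): for a prime `p ≡ 15 (mod 16)` with `p ≡ 2 (mod 3)` or `p ≡ ±2 (mod 5)` or `(p/11) = −1` or
`(p/19) = −1` or `(p/43) = −1` or `(13/p) = −1` (the classes of w4 g12's ladder, `63/64` of `p ≡ 7 (mod 8)`), the UNCONDITIONAL cell data of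
`…CornersThreeFacts.exists_cellData_p` give primes `q ≡ 3`, `l ≡ 5 (mod 8)` with `(q/p) = +1`, `(l/p) = −1` and `h(K) < p` for every imaginary
quadratic `K` of discriminant `−ql`; `…PartnerLadder.exists_witnessField_of` builds `K′ = ℚ(√−ql)` (Heegner for every level whose primes
are `2` or `p`: `−ql ≡ 1 (mod 8)`, `(−ql/p) = +1`); the support of `N(X_A)` is `{2, p}` WITHOUT modularity (§2: good reduction of the `ℤ`-model
`⟨0,0,0,A,0⟩`, `Δ = −64 A³`, at every `r ∤ 2p`, and `not_dvd_conductorNorm_of_hasGoodReductionAtPrime`); the twist is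
`X_A^{(−ql)} = X_{A q² l²}` (`InertBadOffNoQuadraticTwin.quadraticTwist_quartic`); `corank_{ℤ₂} Sel_{2^∞} = 0` by `…QuarticCell.selmerCorank_two_eq_zero`; `j = 1728`, so
`HasCM` (`hasCM_of_j_eq_1728`) and Burungale–Tian's rank-zero `2`-converse gives `r_an = 0`; and `L(X_{A q²l²}, s)` is ENTIRE by the tree
theorem `QuarticTwist.hasEntireLFunction` (Ireland–Rosen 18.6/18.7 — this seat's `Literature/…/QuarticTwistEntireLFunction`, no
Deuring–Hecke leaf), so `r_an = 0` reads `L(1) ≠ 0` (`analyticRank_eq_zero_iff_holds`). Net: the CONCLUSION of crux 21381 for `W = X_p` and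
`W = X_{p³}` on these classes modulo ONE named fact (Burungale–Tian 2026 Thm. 1.1); no Monsky matrix, no Burungale–Flach, no modularity, no
Deuring–Hecke. HONEST FRAMING: a typed sub-corner on one CM family; the crux (all CM `W` of analytic rank one; residual C⁺) is untouched;
BSD is not proved by any of this. THEOREMS ONLY; supports stmt-BirchSwinnertonDyer-21381.
-/

noncomputable section

open scoped Classical NumberField

namespace Summit.BirchSwinnertonDyer.BirchSwinnertonDyer.Theorems.BiquadraticEisensteinDescentHeegnerTwistCouplingInSupplyQuarticCorner

open _root_.WeierstrassCurve Literature.NumberTheory.EllipticCurves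
open IsDedekindDomain Rat.HeightOneSpectrum
open Summit.BirchSwinnertonDyer.BirchSwinnertonDyer.Theorems.BiquadraticEisensteinDescentHeegnerTwistCouplingInSupplyQuarticCellPhiHat
open Summit.BirchSwinnertonDyer.BirchSwinnertonDyer.Theorems.BiquadraticEisensteinDescentHeegnerTwistCouplingInSupplyQuarticCell
open Summit.BirchSwinnertonDyer.BirchSwinnertonDyer.Theorems.BiquadraticEisensteinDescentHeegnerTwistCouplingInSupplyPartnerLadder
  (exists_witnessField_of jacobiSym_neg_mul_eq_one)
open Summit.BirchSwinnertonDyer.BirchSwinnertonDyer.Theorems.BiquadraticEisensteinDescentHeegnerTwistCouplingInSupplyCornersThreeFacts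
  (exists_cellData_p)
open Summit.BirchSwinnertonDyer.BirchSwinnertonDyer.Theorems.BiquadraticEisensteinDescentHeegnerTwistCouplingInSupplyQuarticTwistCorner (j_quartic)
open Summit.BirchSwinnertonDyer.BirchSwinnertonDyer.Theorems.InertBadOffNoQuadraticTwin (quadraticTwist_quartic)

/-! ## §1 The family `X_B : y² = x³ + B x`: CM, fourth-power-freeness, `L(1) ≠ 0` from the corank -/

section Family

/-- **`X_B` has complex multiplication** (by `ℤ[i]`: `j = 1728` by bed-w4 g13's `…QuarticTwistCorner.j_quartic`, then the tree
theorem `hasCM_of_j_eq_1728`). [cite: SilvermanAEC2009, App. C §11, Example 11.3.1] -/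
theorem hasCM_X {B : ℚ} (hB : B ≠ 0) [hE : (⟨0, 0, 0, B, 0⟩ : WeierstrassCurve ℚ).IsElliptic] :
    (⟨0, 0, 0, B, 0⟩ : WeierstrassCurve ℚ).HasCM :=
  Literature.NumberTheory.EllipticCurves.hasCM_of_j_eq_1728 _ (j_quartic hB)

/-- `B = p^k q² l²` (`k ≤ 3`, `p, q, l` distinct primes) is free of fourth powers. [folklore] -/
theorem not_pow_four_dvd {p q l k : ℕ} (hp : p.Prime) (hq : q.Prime) (hl : l.Prime) (hqp : q ≠ p) (hlp : l ≠ p) (hql : q ≠ l)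
    (hk : k ≤ 3) (r : ℕ) (hr : r.Prime) : ¬ (r : ℤ) ^ 4 ∣ (p : ℤ) ^ k * q ^ 2 * l ^ 2 := by
  intro h
  have h' : r ^ 4 ∣ p ^ k * q ^ 2 * l ^ 2 := by exact_mod_cast h
  have hcop : ∀ {a b : ℕ} (m n : ℕ), a.Prime → b.Prime → a ≠ b → Nat.Coprime (a ^ m) (b ^ n) := fun m n ha hb hab =>
    Nat.Coprime.pow m n ((Nat.coprime_primes ha hb).mpr hab)
  have hr4 : 1 < r ^ 4 := Nat.one_lt_pow (by norm_num) hr.one_lt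
  by_cases hrp : r = p
  · subst hrp
    have h1 : r ^ 4 ∣ r ^ k := by
      rw [mul_assoc] at h'
      exact (Nat.Coprime.mul_right (hcop 4 2 hr hq hqp.symm) (hcop 4 2 hr hl hlp.symm)).dvd_of_dvd_mul_right h'
    have := (Nat.pow_dvd_pow_iff_le_right hr.one_lt).mp h1
    omega
  by_cases hrq : r = q
  · subst hrq
    have h1 : r ^ 4 ∣ r ^ 2 := by
      rw [show p ^ k * r ^ 2 * l ^ 2 = r ^ 2 * (p ^ k * l ^ 2) by ring] at h'
      exact (Nat.Coprime.mul_right (hcop 4 k hr hp hrp) (hcop 4 2 hr hl hql)).dvd_of_dvd_mul_right h'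
    have := (Nat.pow_dvd_pow_iff_le_right hr.one_lt).mp h1
    omega
  by_cases hrl : r = l
  · subst hrl
    have h1 : r ^ 4 ∣ r ^ 2 := by
      rw [show p ^ k * q ^ 2 * r ^ 2 = r ^ 2 * (p ^ k * q ^ 2) by ring] at h'
      exact (Nat.Coprime.mul_right (hcop 4 k hr hp hrp) (hcop 4 2 hr hq hrq)).dvd_of_dvd_mul_right h'
    have := (Nat.pow_dvd_pow_iff_le_right hr.one_lt).mp h1
    omega
  · have hc : Nat.Coprime (r ^ 4) (p ^ k * q ^ 2 * l ^ 2) :=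
      Nat.Coprime.mul_right (Nat.Coprime.mul_right (hcop 4 k hr hp hrp) (hcop 4 2 hr hq hrq)) (hcop 4 2 hr hl hrl)
    have h1 : r ^ 4 ∣ 1 := hc.dvd_of_dvd_mul_right (by simpa using h')
    have := Nat.le_of_dvd one_pos h1
    omega

/-- ★ **`L`-form of the quartic cell, ONE named fact**: in the cell (`p ≡ 15 (mod 16)`, `k ∈ {1,3}`, `q ≡ 3 (mod 8)`, `(q/p) = +1`,
`l ≡ 5 (mod 8)`, `(l/p) = −1`), `r_an(X_{p^k q² l²}) = 0` and `L(X_{p^k q² l²}, 1) ≠ 0`, modulo Burungale–Tian's rank-zero `2`-converse for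
CM curves ONLY: the corank vanishes (`…QuarticCell.selmerCorank_two_eq_zero`, unconditional), `j = 1728` gives `HasCM`, and the continuation
needed to read `r_an = 0` as `L(1) ≠ 0` is the tree theorem `QuarticTwist.hasEntireLFunction` (Ireland–Rosen 18.6/18.7), not a named fact.
The instance argument is `…QuarticCell.isElliptic_X`. [cite: BurungaleTian2026, Thm. 1.1] [cite: IrelandRosen1990, Ch. 18 §6 Theorem 7] -/
theorem L_one_ne_zero_X (hBT : burungaleTian_analyticRank_eq_zero_of_selmerCorank_eq_zero_of_hasCM) {p q l k : ℕ} (hp : p.Prime)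
    (hq : q.Prime) (hl : l.Prime) (hp16 : p % 16 = 15) (hq8 : q % 8 = 3) (hl8 : l % 8 = 5) (hJq : jacobiSym (q : ℤ) p = 1)
    (hJl : jacobiSym (l : ℤ) p = -1) (hk : k = 1 ∨ k = 3)
    [hE : (⟨0, 0, 0, (((p : ℤ) ^ k * q ^ 2 * l ^ 2 : ℤ) : ℚ), 0⟩ : WeierstrassCurve ℚ).IsElliptic] :
    (⟨0, 0, 0, (((p : ℤ) ^ k * q ^ 2 * l ^ 2 : ℤ) : ℚ), 0⟩ : WeierstrassCurve ℚ).analyticRank = 0 ∧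
      (⟨0, 0, 0, (((p : ℤ) ^ k * q ^ 2 * l ^ 2 : ℤ) : ℚ), 0⟩ : WeierstrassCurve ℚ).entireLFunction 1 ≠ 0 := by
  haveI : Fact (Nat.Prime 2) := ⟨Nat.prime_two⟩
  set B : ℤ := (p : ℤ) ^ k * q ^ 2 * l ^ 2 with hB
  have hB0 : B ≠ 0 := (b_pos (k := k) hp hq hl).ne'
  have hBQ : (B : ℚ) ≠ 0 := by exact_mod_cast hB0
  have h0 := hBT _ (hasCM_X hBQ) 2 (selmerCorank_two_eq_zero hp hq hl hp16 hq8 hl8 hJq hJl hk)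
  have h4 : ∀ r : ℕ, r.Prime → ¬ (r : ℤ) ^ 4 ∣ B :=
    not_pow_four_dvd hp hq hl (q_ne_p hq hJq) (l_ne_p hl hJl) (by omega) (by omega)
  exact ⟨h0, (analyticRank_eq_zero_iff_holds (W := (⟨0, 0, 0, (B : ℚ), 0⟩ : WeierstrassCurve ℚ))
    (QuarticTwist.hasEntireLFunction hB0 h4)).1 h0⟩

end Family

/-! ## §2 `X_{p^k}`: good reduction away from `2p`, the support of the conductor (no modularity) -/

section Conductor

/-- The `ℤ`-model `⟨0, 0, 0, p^k, 0⟩` maps to `X_{p^k}`. [folklore] -/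
theorem map_XInt (p k : ℕ) :
    (⟨0, 0, 0, (p : ℤ) ^ k, 0⟩ : WeierstrassCurve ℤ).map (Int.castRingHom ℚ) = ⟨0, 0, 0, (p : ℚ) ^ k, 0⟩ := by
  ext <;> simp [WeierstrassCurve.map]

/-- `Δ(⟨0, 0, 0, A, 0⟩) = −64 A³`. [cite: SilvermanAEC2009, III.1 (b₂, b₄, b₆, b₈, Δ)] -/
theorem XInt_Δ (A : ℤ) : (⟨0, 0, 0, A, 0⟩ : WeierstrassCurve ℤ).Δ = -64 * A ^ 3 := by
  simp only [WeierstrassCurve.Δ, WeierstrassCurve.b₂, WeierstrassCurve.b₄, WeierstrassCurve.b₆, WeierstrassCurve.b₈]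
  ring

/-- A prime `r ∤ 2p` does not divide `Δ(X_{p^k}) = −64 p^{3k}`. [folklore] -/
theorem not_dvd_XInt_Δ {p k r : ℕ} (hr : r.Prime) (hrp : ¬ r ∣ 2 * p) :
    ¬ (r : ℤ) ∣ (⟨0, 0, 0, (p : ℤ) ^ k, 0⟩ : WeierstrassCurve ℤ).Δ := by
  rw [XInt_Δ]
  intro h
  have h' : r ∣ 64 * (p ^ k) ^ 3 := by
    have := Int.natAbs_dvd_natAbs.mpr h
    simpa [Int.natAbs_mul, Int.natAbs_pow, Int.natAbs_neg] using this
  rcases (Nat.Prime.dvd_mul hr).mp h' with h64 | hp3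
  · exact hrp ((hr.dvd_of_dvd_pow (show r ∣ 2 ^ 6 by simpa using h64)).mul_right p)
  · exact hrp ((hr.dvd_of_dvd_pow (hr.dvd_of_dvd_pow hp3)).mul_left 2)

/-- **`X_{p^k}` has good reduction at every prime `r ∤ 2p`** (`r ∤ Δ` of the `ℤ`-model; Silverman VII.5.1(a) in the tree's prime-indexed
form). [cite: SilvermanAEC2009, VII.5 Prop. 5.1(a)] -/
theorem hasGoodReductionAtPrime_X {p k r : ℕ} [Fact r.Prime] (hrp : ¬ r ∣ 2 * p) :
    (⟨0, 0, 0, (p : ℚ) ^ k, 0⟩ : WeierstrassCurve ℚ).HasGoodReductionAtPrime r := by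
  obtain ⟨v, rfl⟩ : ∃ v : HeightOneSpectrum (𝓞 ℚ), (primesEquiv v : ℕ) = r :=
    ⟨primesEquiv.symm ⟨r, Fact.out⟩, by rw [Equiv.apply_symm_apply]⟩
  rw [← map_XInt]
  exact (hasGoodReductionAtPrime_iff_hasGoodReductionAt_ringOfIntegers v _).2
    (hasGoodReductionAt_map_of_not_dvd _ v (not_dvd_XInt_Δ Fact.out hrp))

/-- **Every prime divisor of `N(X_{p^k})` is `2` or `p`** (a prime of good reduction does not divide the conductor). No modularity.
[cite: SilvermanATAEC1994, Thm. IV.10.2(a)] -/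
theorem eq_two_or_eq_of_prime_dvd_conductorNorm_X {p k r : ℕ} [(⟨0, 0, 0, (p : ℚ) ^ k, 0⟩ : WeierstrassCurve ℚ).IsElliptic]
    (hp : p.Prime) (hr : r.Prime) (h : r ∣ (⟨0, 0, 0, (p : ℚ) ^ k, 0⟩ : WeierstrassCurve ℚ).conductorNorm ℤ) : r = 2 ∨ r = p := by
  by_contra hne
  push Not at hne
  have hrp : ¬ r ∣ 2 * p := fun hd => by
    rcases (Nat.Prime.dvd_mul hr).mp hd with h2 | hp'
    · exact hne.1 ((Nat.prime_dvd_prime_iff_eq hr Nat.prime_two).mp h2)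
    · exact hne.2 ((Nat.prime_dvd_prime_iff_eq hr hp).mp hp')
  haveI : Fact r.Prime := ⟨hr⟩
  exact not_dvd_conductorNorm_of_hasGoodReductionAtPrime _ (hasGoodReductionAtPrime_X hrp) h

end Conductor

/-! ## §3 ★★ The quartic corner: `W = X_p`, `W = X_{p³}`, `p ≡ 15 (mod 16)` in the ladder classes -/

section Corner

/-- `X_{p^k}^{(−ql)}` is the cell literal `X_{p^k q² l²}`. [cite: SilvermanAEC2009, X.2 and X.5] -/
theorem quadraticTwist_X_neg_mul (p q l k : ℕ) :
    (⟨0, 0, 0, (p : ℚ) ^ k, 0⟩ : WeierstrassCurve ℚ).quadraticTwist ((-((q * l : ℕ) : ℤ) : ℤ) : ℚ) =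
      ⟨0, 0, 0, (((p : ℤ) ^ k * q ^ 2 * l ^ 2 : ℤ) : ℚ), 0⟩ := by
  rw [quadraticTwist_quartic]
  ext <;> push_cast <;> ring

/-- **`X_{p^k}` has complex multiplication** (the crux hypothesis `HasCM`, for the record). [cite: SilvermanAEC2009, App. C §11, Example 11.3.1] -/
theorem hasCM_Xp (p k : ℕ) [Fact p.Prime] [(⟨0, 0, 0, (p : ℚ) ^ k, 0⟩ : WeierstrassCurve ℚ).IsElliptic] :
    (⟨0, 0, 0, (p : ℚ) ^ k, 0⟩ : WeierstrassCurve ℚ).HasCM :=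
  hasCM_X (pow_ne_zero k (by exact_mod_cast (Fact.out : p.Prime).ne_zero))

/-- ★★ **THE QUARTIC CORNER, ONE NAMED FACT.** For every prime `p ≡ 15 (mod 16)` with `p ≡ 2 (mod 3)` or `p ≡ ±2 (mod 5)` or
`(p/11) = −1` or `(p/19) = −1` or `(p/43) = −1` or `(13/p) = −1`, and `W = X_{p^k} : y² = x³ + p^k x` with `k ∈ {1, 3}` (`j = 1728`, CM by
`ℤ[i]`, `p` inert and bad of Kodaira type III / III*, root number `−1`): there is an imaginary quadratic field `K′` (`= ℚ(√−ql)` for the cell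
primes `q ≡ 3`, `l ≡ 5 (mod 8)`, `(q/p) = +1`, `(l/p) = −1` of `exists_cellData_p`) with `4 < |d_{K′}|`, Heegner for `N(W)` (every prime divisor
of `N(W)` is `2` or `p`; `d_{K′} ≡ 1 (mod 8)`, `(d_{K′}/p) = +1`), `L(W^{(d_{K′})}, 1) ≠ 0` (`W^{(−ql)} = X_{p^k q² l²}`: complete `2`-isogeny
descent, UNCONDITIONAL, then Burungale–Tian at the prime `2` and the PROVED continuation), `h(K′) < p` and hence `p ∤ h(K′)` — the CONCLUSION
of crux 21381 for `W`, modulo `hBT` only. The binders `IsGloballyMinimal`, `NeZero N` mirror the crux and are unused.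
[cite: BurungaleTian2026, Thm. 1.1] [cite: SilvermanAEC2009, Prop. X.4.9 and Thm. X.4.2(a)] [cite: Oesterle1988Gauss, II §3 Proposition p. 57 (27)] -/
theorem cruxOnQuarticCorner_of_BT (hBT : burungaleTian_analyticRank_eq_zero_of_selmerCorank_eq_zero_of_hasCM) :
    ∀ (p k : ℕ) [Fact p.Prime] [(⟨0, 0, 0, (p : ℚ) ^ k, 0⟩ : WeierstrassCurve ℚ).IsElliptic]
      [(⟨0, 0, 0, (p : ℚ) ^ k, 0⟩ : WeierstrassCurve ℚ).IsGloballyMinimal]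
      [NeZero ((⟨0, 0, 0, (p : ℚ) ^ k, 0⟩ : WeierstrassCurve ℚ).conductorNorm ℤ)],
      p % 16 = 15 → (k = 1 ∨ k = 3) →
      (p % 3 = 2 ∨ p % 5 = 2 ∨ p % 5 = 3 ∨ jacobiSym (p : ℤ) 11 = -1 ∨ jacobiSym (p : ℤ) 19 = -1 ∨
        jacobiSym (p : ℤ) 43 = -1 ∨ jacobiSym (13 : ℤ) p = -1) →
      ∃ (K : Type) (_ : Field K) (_ : NumberField K),
        IsImaginaryQuadratic K ∧ 4 < (NumberField.discr K).natAbs ∧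
        SatisfiesHeegnerHypothesis ((⟨0, 0, 0, (p : ℚ) ^ k, 0⟩ : WeierstrassCurve ℚ).conductorNorm ℤ) K ∧
        ((⟨0, 0, 0, (p : ℚ) ^ k, 0⟩ : WeierstrassCurve ℚ).quadraticTwist (NumberField.discr K : ℚ)).entireLFunction 1 ≠ 0 ∧
        NumberField.classNumber K < p ∧ ¬ p ∣ NumberField.classNumber K := by
  intro p k hpF _ _ _ hp16 hk hcase
  have hp : p.Prime := hpF.out
  obtain ⟨q, l, hq, hq8, hl, hl8, hJq, hJl, hh⟩ := exists_cellData_p hp (by omega) hcase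
  obtain ⟨K, iF, iN, hK, hdK, hH', hcl⟩ := exists_witnessField_of (N := (⟨0, 0, 0, (p : ℚ) ^ k, 0⟩ : WeierstrassCurve ℚ).conductorNorm ℤ)
    hq hq8 hl hl8 (jacobiSym_neg_mul_eq_one (by omega) hJq hJl) hh (fun r hr hrN => eq_two_or_eq_of_prime_dvd_conductorNorm_X hp hr hrN)
  refine ⟨K, iF, iN, hK, ?_, hH', ?_, hcl, fun hdvd => absurd (Nat.le_of_dvd (NumberField.classNumber_pos K) hdvd) (not_le.mpr hcl)⟩
  · rw [hdK, Int.natAbs_neg, Int.natAbs_natCast]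
    have h3 : 3 ≤ q := by have := hq.two_le; omega
    have h5 : 5 ≤ l := by have := hl.two_le; omega
    calc 4 < 3 * 5 := by norm_num
      _ ≤ q * l := Nat.mul_le_mul h3 h5
  · rw [hdK, quadraticTwist_X_neg_mul]
    haveI := isElliptic_X (b_pos (k := k) hp hq hl).ne'
    exact (L_one_ne_zero_X hBT hp hq hl hp16 hq8 hl8 hJq hJl hk).2

end Corner

end Summit.BirchSwinnertonDyer.BirchSwinnertonDyer.Theorems.BiquadraticEisensteinDescentHeegnerTwistCouplingInSupplyQuarticCorner

end
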